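import Literature.NumberTheory.NumberFields.UnramifiedCyclicDegreeDvdClassNumber
import Literature.NumberTheory.NumberFields.InertiaGeneratesGalois
import Literature.NumberTheory.EllipticCurves.OpenImageMazurCharacterProofs
import HarnessLib

/-!
# A Galois character trivial on every inertia group has order dividing the class number
# (Hilbert class field, cyclic case: Cox Thm. 8.10 / Cor. 5.24, in the Galois-character form
# of Mazur 1978 §5)

PROOF-ONLY file (theorems only, no definition, no named fact, no `sorry`), topic
`NumberTheory/NumberFields`.  It generalises the tree's `ℚ`-statement
`Mazur1978.monoidHom_eq_one_of_forall_inertia` («a character of `Γ_ℚ` with open kernel which is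
trivial on every inertia group is trivial» — Minkowski) to an arbitrary number field `K` WITHOUT
REAL PLACES, where Minkowski's theorem is replaced by the tree's PROVED cyclic Hilbert-class-field
divisibility `finrank_dvd_classNumber_of_isUnramifiedIn` (Cox, *Primes of the form x² + ny²*,
Cor. 5.24 with Thm. 8.10: an everywhere unramified cyclic extension `F/K` has `[F : K] ∣ h_K`):

* §1 `index_dvd_classNumber_of_inertia_le` (finite level) — for `L/K` finite Galois with group
  `G` and a normal subgroup `N ⊴ G` with `G ⧸ N` cyclic which CONTAINS EVERY INERTIA GROUP
  `I(Q)`, `Q` a maximal ideal of `𝓞 L`: `[G : N] ∣ h_K` (the fixed field `F = L^N` is cyclic over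
  `K` and unramified at every finite prime — multiplicativity `e(Q|K) = e(𝔮|K)·e(Q|F)` with
  `#I_G(Q) = e(Q|K)`, `#I_N(Q) = e(Q|F)` and `I_G(Q) ↪ I_N(Q)`, exactly as in the tree's proof of
  Cassels' arithmetic monodromy `NumberFields.iSup_inertia_eq_top`);
* §2 `card_range_dvd_classNumber_of_forall_inertia` — for a homomorphism `ψ : Γ_K → M` to a
  commutative group with CYCLIC image… more precisely to a cyclic `M`, with open kernel, trivial on
  the inertia group `I_𝔓 ≤ Γ_K` of every prime `𝔓` of `\bar ℤ_K`: `#ψ(Γ_K) ∣ h_K` (the fixed field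
  of `ker ψ` is a finite Galois `L/K`; inertia groups of `Gal(L/K)` lift to absolute inertia
  groups, Serre *Local Fields* I §7 Prop. 22 (b) = tree `exists_mem_inertia_absRestrictNormalHom_eq`;
  then §1 with `N = ker`);
* §3 the two forms used by descents: `monoidHom_eq_one_of_forall_inertia_of_classNumber_eq_one`
  (`h_K = 1`, `M` cyclic ⟹ `ψ = 1`) and `monoidHom_eq_one_of_forall_inertia_of_prime_card`
  (`#M = p` prime, `p ∤ h_K` ⟹ `ψ = 1`) — «`K` has no everywhere unramified `ℤ/p`-extension when
  `p ∤ h_K`», the input of Mazur's constant-kernel isogeny descent over `K` (B. Mazur, *Modular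
  curves and the Eisenstein ideal*, Ch. III §3, global step; file
  `EllipticCurves/ConstantKernelIsogenySelmerTrivialNumberField`).

The hypothesis «no real place» (`IsEmpty (K →+* ℝ)`) is that of the tree's reciprocity theorem
(Cox counts real places as ramifying); it holds for every imaginary quadratic field
(`isEmpty_ringHom_real_of_sq_eq`), in particular for `ℚ(i)` and `ℚ(√−3)` (`h_K = 1`).

## References

* [Cox2013] D. A. Cox, *Primes of the form x² + ny²*, 2nd ed. (2013), §5.C Cor. 5.24, §8.A
  Thm. 8.10.
* [Mazur1978] B. Mazur, *Rational isogenies of prime degree*, Invent. Math. 44 (1978), §5 (p. 152).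
* [Mazur1977] B. Mazur, *Modular curves and the Eisenstein ideal*, Publ. Math. IHÉS 47 (1977),
  Ch. I §1(g), Ch. III §3.
* [SerreLocalFields1979] J.-P. Serre, *Local Fields*, GTM 67, Ch. I §7 Prop. 22 (b).
* [Cassels1986] J. W. S. Cassels, *Local Fields*, Ch. 10 §12, Thm. 12.1.
-/

noncomputable section

open NumberField IsDedekindDomain Field Ideal
open scoped Pointwise

universe u

namespace Literature.NumberTheory.NumberFields

open Literature.NumberTheory.GaloisRepresentations

/-! ## §1 Finite level: a normal subgroup containing all inertia groups has index dividing `h_K` -/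

section Finite

variable {K L : Type u} [Field K] [NumberField K] [Field L] [NumberField L] [Algebra K L]
  [IsGalois K L]

/-- **Cyclic Hilbert-class-field bound, inertia form.** Let `L/K` be a finite Galois extension of
number fields, `K` without real places, and `N ⊴ Gal(L/K)` a normal subgroup with cyclic quotient
containing the inertia group of every maximal ideal of `𝓞 L`.  Then `[Gal(L/K) : N] ∣ h_K`: the
fixed field `L^N` is a cyclic extension of `K` unramified at every finite prime, so its degree
divides the class number (Cox Cor. 5.24 / Thm. 8.10, tree
`finrank_dvd_classNumber_of_isUnramifiedIn`). [cite: Cox2013, §5.C Cor. 5.24; §8.A Thm. 8.10]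
[cite: Cassels1986, Ch. 10 §12, Thm. 12.1] -/
theorem index_dvd_classNumber_of_inertia_le (hK : IsEmpty (K →+* ℝ))
    (N : Subgroup (L ≃ₐ[K] L)) [N.Normal] [IsCyclic ((L ≃ₐ[K] L) ⧸ N)]
    (h : ∀ (Q : Ideal (𝓞 L)) [Q.IsMaximal], Q.inertia (L ≃ₐ[K] L) ≤ N) :
    N.index ∣ classNumber K := by
  haveI : FiniteDimensional K L := Module.Finite.of_restrictScalars_finite ℚ K L
  set F : IntermediateField K L := IntermediateField.fixedField N with hFdef
  haveI : IsGalois K F := IsGalois.of_fixedField_normal_subgroup N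
  -- `Gal(F/K) ≅ Gal(L/K) ⧸ N` is cyclic
  haveI : IsCyclic (F ≃ₐ[K] F) :=
    isCyclic_of_surjective (IsGalois.normalAutEquivQuotient N).toMonoidHom
      (IsGalois.normalAutEquivQuotient N).surjective
  -- `N` is a Galois group of `L/F`
  haveI : IsGaloisGroup N F L := IsGaloisGroup.subgroup (L ≃ₐ[K] L) K L N
  -- `F/K` is unramified at every finite prime of `K`
  have hunr : ∀ v : HeightOneSpectrum (𝓞 K), Algebra.IsUnramifiedIn (𝓞 F) v.asIdeal := by
    intro v 𝔮 h𝔮prime h𝔮over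
    have h𝔮0 : 𝔮 ≠ ⊥ := Ideal.ne_bot_of_liesOver_of_ne_bot v.ne_bot 𝔮
    haveI : 𝔮.IsMaximal := h𝔮prime.isMaximal h𝔮0
    -- a maximal ideal `Q` of `𝓞 L` above `𝔮`
    obtain ⟨Q, hQmax, hQ𝔮⟩ := exists_maximal_ideal_liesOver_of_isIntegral (S := 𝓞 L) 𝔮
    have hunder : Q.under (𝓞 F) = 𝔮 := hQ𝔮.over.symm
    -- `e(Q|K) = e(𝔮|K) · e(Q|F)`, `#I_G(Q) = e(Q|K)`, `#I_N(Q) = e(Q|F)`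
    have htower := Ideal.ramificationIdx_tower (R := 𝓞 K) (Q.under (𝓞 F)) Q
    rw [hunder] at htower
    have hG := card_inertia_eq_ramificationIdx L (L ≃ₐ[K] L) K Q
    have hN := card_inertia_eq_ramificationIdx L N F Q
    -- `I_G(Q) ↪ I_N(Q)` since `I_G(Q) ≤ N`
    have hle : Nat.card (Q.inertia (L ≃ₐ[K] L)) ≤ Nat.card (Q.inertia N) := by
      refine Nat.card_le_card_of_injective
        (fun σ => ⟨⟨σ.1, h Q σ.2⟩, fun x => σ.2 x⟩) fun a b hab => ?_
      exact Subtype.ext (congrArg (fun t : Q.inertia N => ((t : N) : L ≃ₐ[K] L)) hab)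
    have hpos : 0 < Nat.card (Q.inertia (L ≃ₐ[K] L)) := Nat.card_pos
    replace hle := hle.trans_eq hN
    rw [hG, htower] at hle hpos
    -- `e(𝔮|K) · e(Q|F) ≤ e(Q|F)` and `0 < e(𝔮|K) · e(Q|F)` force `e(𝔮|K) = 1`
    have hF0 : 0 < Q.ramificationIdx (𝓞 F) := Nat.pos_of_mul_pos_left hpos
    have h1 : 𝔮.ramificationIdx (𝓞 K) ≤ 1 := by
      have : 𝔮.ramificationIdx (𝓞 K) * Q.ramificationIdx (𝓞 F) ≤ 1 * Q.ramificationIdx (𝓞 F) := by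
        rwa [one_mul]
      exact Nat.le_of_mul_le_mul_right this hF0
    have h2 : 0 < 𝔮.ramificationIdx (𝓞 K) := Nat.pos_of_mul_pos_right hpos
    exact Ideal.ramificationIdx_eq_one_iff.mp (le_antisymm h1 h2)
  have hdvd := finrank_dvd_classNumber_of_isUnramifiedIn K F hK hunr
  -- `[F : K] = #Gal(F/K) = #(Gal(L/K) ⧸ N) = [G : N]`
  have hfin : Module.finrank K F = N.index := by
    rw [← IsGalois.card_aut_eq_finrank, Subgroup.index,
      Nat.card_congr (IsGalois.normalAutEquivQuotient N).toEquiv]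
  rwa [hfin] at hdvd

end Finite

/-! ## §2 Absolute form: characters of `Γ_K` trivial on all inertia groups -/

section Absolute

variable {K : Type u} [Field K] [NumberField K]

/-- **A Galois character with open kernel, trivial on every inertia group, has image of order
dividing the class number** (for `K` without real places and cyclic target).  Let `M` be a
cyclic group (written multiplicatively, commutative) and `ψ : Γ_K → M` a homomorphism with open
kernel which kills the inertia group `I_𝔓 ≤ Γ_K` of every prime `𝔓` of `\bar ℤ_K` above every
finite place `v` of `K`.  Then `#ψ(Γ_K) ∣ h_K`.  Proof: `ψ` factors through `Gal(L/K)`, `L` the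
(finite Galois) fixed field of `ker ψ`; every inertia group `I(Q) ≤ Gal(L/K)` is the image of an
absolute inertia group (Serre I §7 Prop. 22 (b), tree `exists_mem_inertia_absRestrictNormalHom_eq`),
so lies in the kernel of the induced character `ψ'`; and `Gal(L/K) ⧸ ker ψ' ≅ ψ(Γ_K)` is cyclic,
so §1 applies.  For `K = ℚ` (`h = 1`) this is the tree's
`Mazur1978.monoidHom_eq_one_of_forall_inertia`. [cite: Cox2013, §8.A Thm. 8.10]
[cite: Mazur1978, §5 (p. 152)] [cite: SerreLocalFields1979, Ch. I §7 Prop. 22(b)] -/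
theorem card_range_dvd_classNumber_of_forall_inertia (hK : IsEmpty (K →+* ℝ))
    {M : Type*} [CommGroup M] [IsCyclic M] (ψ : absoluteGaloisGroup K →* M)
    (hker : IsOpen ((ψ.ker : Subgroup (absoluteGaloisGroup K)) : Set (absoluteGaloisGroup K)))
    (h : ∀ (v : HeightOneSpectrum (𝓞 K)), ∀ 𝔓 ∈ v.primesAbove,
      ∀ τ ∈ 𝔓.inertia (absoluteGaloisGroup K), ψ τ = 1) :
    Nat.card ψ.range ∣ classNumber K := by
  -- (a) the fixed field `L` of `ker ψ`: finite Galois over `K`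
  set U : Subgroup (absoluteGaloisGroup K) := ψ.ker with hUdef
  haveI hUnormal : U.Normal := MonoidHom.normal_ker ψ
  let U' : Subgroup (AlgebraicClosure K ≃ₐ[K] AlgebraicClosure K) :=
    U.map (absoluteGaloisGroup.toAlgEquiv K).toMonoidHom
  have hU'open : IsOpen (U' : Set (AlgebraicClosure K ≃ₐ[K] AlgebraicClosure K)) := by
    have hHeq : (U' : Set (AlgebraicClosure K ≃ₐ[K] AlgebraicClosure K)) =
        (absoluteGaloisGroup.toAlgEquiv K).symm ⁻¹' U := by
      ext f
      rw [SetLike.mem_coe, Set.mem_preimage, SetLike.mem_coe]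
      exact Subgroup.mem_map_equiv
    have hcont : Continuous (absoluteGaloisGroup.toAlgEquiv K).symm := continuous_id
    rw [hHeq]
    exact hker.preimage hcont
  have hU'closed : IsClosed (U' : Set (AlgebraicClosure K ≃ₐ[K] AlgebraicClosure K)) :=
    Subgroup.isClosed_of_isOpen _ hU'open
  have hU'normal : U'.Normal := hUnormal.map _ (absoluteGaloisGroup.toAlgEquiv K).surjective
  let L : IntermediateField K (AlgebraicClosure K) := IntermediateField.fixedField U'
  have hfix : L.fixingSubgroup = U' :=
    InfiniteGalois.fixingSubgroup_fixedField (⟨U', hU'closed⟩ : ClosedSubgroup _)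
  haveI : FiniteDimensional K L :=
    (InfiniteGalois.isOpen_iff_finite L).mp (by rw [hfix]; exact hU'open)
  haveI : IsGalois K L :=
    (InfiniteGalois.normal_iff_isGalois L).mp (by rw [hfix]; exact hU'normal)
  haveI : NumberField L := NumberField.of_module_finite K L
  -- (b) `ψ` factors through `ρ : Γ_K → Gal(L/K)`
  set ρ : absoluteGaloisGroup K →* (L ≃ₐ[K] L) := absRestrictNormalHom L with hρdef
  have hρker : ρ.ker ≤ ψ.ker := by
    intro σ hσ
    rw [MonoidHom.mem_ker] at hσ
    have hσL : absoluteGaloisGroup.toAlgEquiv K σ ∈ L.fixingSubgroup := by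
      rw [IntermediateField.mem_fixingSubgroup_iff]
      intro x hx
      have h1 := AlgEquiv.restrictNormalHom_apply L (absoluteGaloisGroup.toAlgEquiv K σ) ⟨x, hx⟩
      change ((ρ σ ⟨x, hx⟩ : L) : AlgebraicClosure K) = _ at h1
      rw [hσ, AlgEquiv.one_apply] at h1
      exact h1.symm
    rw [hfix] at hσL
    obtain ⟨τ, hτU, hτσ⟩ := Subgroup.mem_map.mp hσL
    have hτ : τ = σ := (absoluteGaloisGroup.toAlgEquiv K).injective hτσ
    rw [← hUdef, ← hτ]
    exact hτU
  have hsurj : Function.Surjective ρ :=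
    (AlgEquiv.restrictNormalHom_surjective (F := K) (K₁ := L) (AlgebraicClosure K)).comp
      (absoluteGaloisGroup.toAlgEquiv K).surjective
  have hs : Function.RightInverse (Function.surjInv hsurj) ρ := Function.rightInverse_surjInv hsurj
  set ψ' : (L ≃ₐ[K] L) →* M :=
    MonoidHom.liftOfRightInverse ρ (Function.surjInv hsurj) hs ⟨ψ, hρker⟩ with hψ'def
  have hψ'ρ : ∀ σ, ψ' (ρ σ) = ψ σ := fun σ =>
    MonoidHom.liftOfRightInverse_comp_apply ρ (Function.surjInv hsurj) hs ⟨ψ, hρker⟩ σ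
  -- (c) every inertia group of `𝓞 L` dies under `ψ'`
  have hinert : ∀ (Q : Ideal (𝓞 L)) [Q.IsMaximal], Q.inertia (L ≃ₐ[K] L) ≤ ψ'.ker := by
    intro Q _ g hg
    -- the place `v` of `K` under `Q`
    haveI : (Q.under (𝓞 K)).IsMaximal := Ideal.IsMaximal.under (𝓞 K) Q
    have hne : Q.under (𝓞 K) ≠ ⊥ :=
      Ring.ne_bot_of_isMaximal_of_not_isField inferInstance (RingOfIntegers.not_isField K)
    set v : HeightOneSpectrum (𝓞 K) := ⟨Q.under (𝓞 K), inferInstance, hne⟩ with hvdef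
    haveI hQover : Q.LiesOver v.asIdeal := ⟨rfl⟩
    -- a prime `𝔓` of `\bar ℤ_K` above `Q`
    set ι := EllipticCurves.ringOfIntegersToIntegralClosure (k := K) (Ω := AlgebraicClosure K) L
      with hιdef
    have hιalg : ∀ x : 𝓞 K, ι (algebraMap (𝓞 K) (𝓞 L) x) =
        algebraMap (𝓞 K) (absIntegers (𝓞 K) K) x := fun x => rfl
    obtain ⟨𝔓, h𝔓prime, h𝔓Q⟩ : ∃ 𝔓 : Ideal (absIntegers (𝓞 K) K), 𝔓.IsPrime ∧ 𝔓.comap ι = Q := by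
      letI : Algebra (𝓞 L) (absIntegers (𝓞 K) K) := ι.toAlgebra
      haveI : IsScalarTower (𝓞 K) (𝓞 L) (absIntegers (𝓞 K) K) :=
        IsScalarTower.of_algebraMap_eq fun x => (hιalg x).symm
      haveI : Algebra.IsIntegral (𝓞 L) (absIntegers (𝓞 K) K) :=
        ⟨fun x => (Algebra.IsIntegral.isIntegral (R := 𝓞 K) x).tower_top⟩
      obtain ⟨𝔓, -, h𝔓prime, h𝔓Q⟩ := Ideal.exists_ideal_over_prime_of_isIntegral Q
        (⊥ : Ideal (absIntegers (𝓞 K) K))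
        (fun x hx => by
          rw [Ideal.mem_comap, Ideal.mem_bot] at hx
          have hx0 : x = 0 :=
            EllipticCurves.ringOfIntegersToIntegralClosure_injective L
              (hx.trans (map_zero _).symm)
          rw [hx0]
          exact Q.zero_mem)
      exact ⟨𝔓, h𝔓prime, h𝔓Q⟩
    haveI := h𝔓prime
    have h𝔓v : 𝔓 ∈ v.primesAbove := by
      refine ⟨h𝔓prime, ⟨?_⟩⟩
      rw [hQover.over, ← h𝔓Q]
      ext x
      simp only [Ideal.under, Ideal.mem_comap]
      exact Iff.of_eq (congrArg (· ∈ 𝔓) (hιalg x))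
    -- `g` is an inertia element for the action on `integralClosure (𝓞 K) L` at `𝔓 ∩ L` as well
    have hg' : g ∈ (𝔓.comap (L.integralClosureToAbsIntegers (𝓞 K))).inertia (L ≃ₐ[K] L) := by
      haveI : @IsScalarTower ℤ (𝓞 K) L Algebra.toSMul Algebra.toSMul Algebra.toSMul :=
        IsScalarTower.of_algebraMap_eq' (RingHom.ext_int _ _)
      intro x
      have hxint : IsIntegral ℤ (x : L) := isIntegral_trans (R := ℤ) (A := 𝓞 K) (x : L) x.2
      set y : 𝓞 L := ⟨(x : L), hxint⟩ with hy
      have hgy : ι (g • y - y) ∈ 𝔓 := by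
        have hgQ : g • y - y ∈ Q := hg y
        rw [← h𝔓Q] at hgQ
        exact hgQ
      have e : ι (g • y - y) = L.integralClosureToAbsIntegers (𝓞 K) (g • x - x) := Subtype.ext rfl
      rw [e] at hgy
      exact hgy
    obtain ⟨σ, hσI, hσg⟩ := exists_mem_inertia_absRestrictNormalHom_eq 𝔓 L hg'
    rw [MonoidHom.mem_ker]
    have e1 : ψ' g = ψ' (ρ σ) := congrArg ψ' hσg.symm
    rw [e1, hψ'ρ σ]
    exact h v 𝔓 h𝔓v σ hσI
  -- (d) §1 with `N = ker ψ'`: `[Gal(L/K) : ker ψ'] = #ψ'(Gal(L/K)) = #ψ(Γ_K)` divides `h_K`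
  haveI : (ψ'.ker).Normal := MonoidHom.normal_ker ψ'
  haveI : IsCyclic ((L ≃ₐ[K] L) ⧸ ψ'.ker) :=
    isCyclic_of_injective (QuotientGroup.kerLift ψ') (QuotientGroup.kerLift_injective ψ')
  have hidx := index_dvd_classNumber_of_inertia_le hK ψ'.ker (fun Q _ => hinert Q)
  have hrange : ψ'.range = ψ.range := by
    ext m
    constructor
    · rintro ⟨g, rfl⟩
      obtain ⟨σ, rfl⟩ := hsurj g
      exact ⟨σ, (hψ'ρ σ).symm⟩
    · rintro ⟨σ, rfl⟩
      exact ⟨ρ σ, hψ'ρ σ⟩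
  rw [Subgroup.index, Nat.card_congr (QuotientGroup.quotientKerEquivRange ψ').toEquiv,
    hrange] at hidx
  exact hidx

/-- **Class number one: `K` has no everywhere unramified cyclic extension, character form.**
If `K` has no real place and `h_K = 1`, a homomorphism `ψ : Γ_K → M` to a cyclic group with open
kernel which is trivial on every inertia group is trivial (e.g. `K = ℚ(i)`, `ℚ(√−3)`; for
`K = ℚ` this is Minkowski's theorem in the form `Mazur1978.monoidHom_eq_one_of_forall_inertia`).
[cite: Cox2013, §8.A Thm. 8.10] [cite: Mazur1978, §5 (p. 152)] -/
theorem monoidHom_eq_one_of_forall_inertia_of_classNumber_eq_one (hK : IsEmpty (K →+* ℝ))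
    (h1 : classNumber K = 1) {M : Type*} [CommGroup M] [IsCyclic M]
    (ψ : absoluteGaloisGroup K →* M)
    (hker : IsOpen ((ψ.ker : Subgroup (absoluteGaloisGroup K)) : Set (absoluteGaloisGroup K)))
    (h : ∀ (v : HeightOneSpectrum (𝓞 K)), ∀ 𝔓 ∈ v.primesAbove,
      ∀ τ ∈ 𝔓.inertia (absoluteGaloisGroup K), ψ τ = 1) :
    ψ = 1 := by
  have hcard := card_range_dvd_classNumber_of_forall_inertia hK ψ hker h
  rw [h1, Nat.dvd_one, Nat.card_eq_one_iff_unique] at hcard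
  obtain ⟨hsub, -⟩ := hcard
  ext σ
  have hmem : (⟨ψ σ, σ, rfl⟩ : ψ.range) = ⟨1, one_mem _⟩ := Subsingleton.elim _ _
  rw [MonoidHom.one_apply]
  exact congrArg Subtype.val hmem

/-- **No everywhere unramified `ℤ/p`-extension when `p ∤ h_K`, character form.** If `K` has no
real place, `M` has prime order `p` and `p ∤ h_K`, then a homomorphism `ψ : Γ_K → M` with open
kernel which is trivial on every inertia group is trivial (Mazur, *Eisenstein ideal*, Ch. I §1(g):
the `ℤ/p`-extensions of `K` unramified everywhere are counted by `Cl(K)/p`).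
[cite: Mazur1977, Ch. I §1(g)] [cite: Cox2013, §5.C Cor. 5.24] -/
theorem monoidHom_eq_one_of_forall_inertia_of_prime_card (hK : IsEmpty (K →+* ℝ))
    {M : Type*} [CommGroup M] {p : ℕ} (hp : p.Prime) (hM : Nat.card M = p)
    (hpK : ¬ p ∣ classNumber K) (ψ : absoluteGaloisGroup K →* M)
    (hker : IsOpen ((ψ.ker : Subgroup (absoluteGaloisGroup K)) : Set (absoluteGaloisGroup K)))
    (h : ∀ (v : HeightOneSpectrum (𝓞 K)), ∀ 𝔓 ∈ v.primesAbove,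
      ∀ τ ∈ 𝔓.inertia (absoluteGaloisGroup K), ψ τ = 1) :
    ψ = 1 := by
  haveI : Fact p.Prime := ⟨hp⟩
  haveI : IsCyclic M := isCyclic_of_prime_card hM
  haveI : Finite M := Nat.finite_of_card_ne_zero (by rw [hM]; exact hp.ne_zero)
  have hcard := card_range_dvd_classNumber_of_forall_inertia hK ψ hker h
  have hdvdM : Nat.card ψ.range ∣ p := hM ▸ Subgroup.card_subgroup_dvd_card ψ.range
  rcases (Nat.dvd_prime hp).mp hdvdM with h1 | hp'
  · rw [Nat.card_eq_one_iff_unique] at h1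
    obtain ⟨hsub, -⟩ := h1
    ext σ
    have hmem : (⟨ψ σ, σ, rfl⟩ : ψ.range) = ⟨1, one_mem _⟩ := Subsingleton.elim _ _
    rw [MonoidHom.one_apply]
    exact congrArg Subtype.val hmem
  · exact absurd (hp' ▸ hcard) hpK

end Absolute

end Literature.NumberTheory.NumberFields

end
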